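import Mathlib
import Literature.AlgebraicGeometry.Resolution.CobordantGame
import Summits.ResolutionOfSingularities.ResolutionOfSingularities.Theorems.WeightedInvariantLocalWeightedDropCharTwoDoublePointReduction
import Summits.ResolutionOfSingularities.ResolutionOfSingularities.Theorems.WeightedInvariantLocalWeightedDropWeierstrassForm

/-!
# `WeightedInvariant.LocalWeightedDrop`, line `hasse-ridge-face-selection`: CORE W″ at `d = 2` ⟺ the MONIC char-`2`
# double points `y² + A₁(x) y + A₀(x)` are won

Crux item stmt-ResolutionOfSingularities-8899 `LocalWeightedDrop` (route `ResolutionOfSingularities/WeightedInvariant`),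
serving the door `WeightedConstruction` stmt-ResolutionOfSingularities-0571.  [OURS · L1 W4.3, chain w43, stub worker 3:
assembly of N2 (`charTwoDoublePointSurfaceWon_of_normalForms`) with the Weierstrass form
(`normalFormsWon_of_monicFormsWon`).  Not a statement of any manuscript.]

BOOKKEEPING ONLY.  The registered piece S2 `stub_charTwoDoublePointSurfaceWon` of skeleton v19 (statement verbatim) is
EQUIVALENT to the statement `MonicDoublePointsWon`-shape hypothesis below: over every algebraically closed field of
characteristic `2`, given the singular germs in `≤ 2` variables, every monic `y² + A₁(x₁,x₂) y + A₀(x₁,x₂)` with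
`ord A₁ ≥ 2`, `ord A₀ ≥ 3` is won in the local weighted resolution game (`charTwoDoublePointSurfaceWon_of_monicForms`,
`monicFormsWon_of_charTwoDoublePointSurfaceWon`).  This is the position space of the wild coefficient game D1 of
CRUX-PLAN w43 §3C: pairs `(A₁, A₀) ∈ k[[x₁,x₂]]²`, no unit, no Tschirnhaus, stable under `y ↦ y + φ(x)`.
-/

set_option linter.dupNamespace false -- mandated namespace of this single-conjunct summit

namespace Summit.ResolutionOfSingularities.ResolutionOfSingularities.Theorems

open Literature.AlgebraicGeometry.Resolution Literature.AlgebraicGeometry.Resolution.CobordantGame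

/-- S2 FROM THE MONIC DOUBLE POINTS: if over every algebraically closed field of characteristic `2`, given the singular
germs in `≤ 2` variables, every monic `y² + A₁(x) y + A₀(x)` (`y = X (Fin.last 2)`, `ord A₁ ≥ 2`, `ord A₀ ≥ 3`) is won,
then the registered piece `stub_charTwoDoublePointSurfaceWon` holds (conclusion verbatim). -/
theorem charTwoDoublePointSurfaceWon_of_monicForms
    (hmonic : ∀ (k : Type) [Field k] [CharP k 2] [IsAlgClosed k],
      (∀ m : ℕ, m < 3 → ∀ g : MvPowerSeries (Fin m) k,
        CobordantGame.IsSingular k g → CobordantGame.Won k m g) →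
      ∀ (A₀ A₁ : MvPowerSeries (Fin 2) k), (2 : ℕ∞) < A₀.order → (1 : ℕ∞) < A₁.order →
        CobordantGame.Won k 3 (MvPowerSeries.X (Fin.last 2) ^ 2 +
          (MvPowerSeries.rename (Fin.succAboveEmb (Fin.last 2)) A₀ +
            MvPowerSeries.rename (Fin.succAboveEmb (Fin.last 2)) A₁ * MvPowerSeries.X (Fin.last 2)))) :
    ∀ (k : Type) [Field k] [CharP k 2] [IsAlgClosed k],
      (∀ m : ℕ, m < 3 → ∀ g : MvPowerSeries (Fin m) k,
        CobordantGame.IsSingular k g → CobordantGame.Won k m g) →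
      ∀ (f : MvPowerSeries (Fin 3) k), CobordantGame.IsSingular k f →
      (∀ g : MvPowerSeries (Fin 3) k, CobordantGame.IsSingular k g → g.order < f.order →
        CobordantGame.Won k 3 g) →
      f.order = 2 →
      (∃ ℓ : Fin 3 → k, ∀ i j : Fin 3,
        MvPowerSeries.coeff (Finsupp.single i 1 + Finsupp.single j 1) f =
          MvPowerSeries.coeff (Finsupp.single i 1 + Finsupp.single j 1)
            ((∑ l, MvPowerSeries.C (ℓ l) * MvPowerSeries.X l) ^ 2)) →
      CobordantGame.Won k 3 f :=
  charTwoDoublePointSurfaceWon_of_normalForms fun k _ _ _ =>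
    normalFormsWon_of_monicFormsWon (m := 2) (hmonic k)

/-- THE CONVERSE: S2 (as a hypothesis, verbatim) wins every monic double point `y² + A₁ y + A₀` (`ord A₁ ≥ 2`,
`ord A₀ ≥ 3`) — the case `U = 1` of `normalFormsWon_of_charTwoDoublePointSurfaceWon`. -/
theorem monicFormsWon_of_charTwoDoublePointSurfaceWon
    (hS2 : ∀ (k : Type) [Field k] [CharP k 2] [IsAlgClosed k],
      (∀ m : ℕ, m < 3 → ∀ g : MvPowerSeries (Fin m) k,
        CobordantGame.IsSingular k g → CobordantGame.Won k m g) →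
      ∀ (f : MvPowerSeries (Fin 3) k), CobordantGame.IsSingular k f →
      (∀ g : MvPowerSeries (Fin 3) k, CobordantGame.IsSingular k g → g.order < f.order →
        CobordantGame.Won k 3 g) →
      f.order = 2 →
      (∃ ℓ : Fin 3 → k, ∀ i j : Fin 3,
        MvPowerSeries.coeff (Finsupp.single i 1 + Finsupp.single j 1) f =
          MvPowerSeries.coeff (Finsupp.single i 1 + Finsupp.single j 1)
            ((∑ l, MvPowerSeries.C (ℓ l) * MvPowerSeries.X l) ^ 2)) →
      CobordantGame.Won k 3 f) :
    ∀ (k : Type) [Field k] [CharP k 2] [IsAlgClosed k],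
      (∀ m : ℕ, m < 3 → ∀ g : MvPowerSeries (Fin m) k,
        CobordantGame.IsSingular k g → CobordantGame.Won k m g) →
      ∀ (A₀ A₁ : MvPowerSeries (Fin 2) k), (2 : ℕ∞) < A₀.order → (1 : ℕ∞) < A₁.order →
        CobordantGame.Won k 3 (MvPowerSeries.X (Fin.last 2) ^ 2 +
          (MvPowerSeries.rename (Fin.succAboveEmb (Fin.last 2)) A₀ +
            MvPowerSeries.rename (Fin.succAboveEmb (Fin.last 2)) A₁ * MvPowerSeries.X (Fin.last 2))) := by
  intro k _ _ _ IH A₀ A₁ hA₀ hA₁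
  have h := normalFormsWon_of_charTwoDoublePointSurfaceWon hS2 k IH 1 A₀ A₁ (map_one _) hA₀ hA₁
  rwa [one_mul] at h

end Summit.ResolutionOfSingularities.ResolutionOfSingularities.Theorems
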